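import Summits.KontsevichZagierPeriods.KontsevichZagierPeriods.Theorems.TerasomaMultiplicationBetaCancellationStubTameFormAux5
import Summits.KontsevichZagierPeriods.KontsevichZagierPeriods.Theorems.TerasomaMultiplicationBetaCancellationStubTameFormAux13

/-!
# `BetaCancellation` (stmt-KontsevichZagierPeriods-13633), line `divisor-slicing-transshipment` — stub `stub_tameForm`, auxiliary file 15: absorbing a spectator into a catalytic cylinder

**Absorption.** Let `K = [ℝ, 1/(1+x²)]` be the Cauchy line. A measured set `(s, ρ)` in
`ℝ¹⁺ᴰ`, thrice stabilised to `s × (0,1)³ ⊆ ℝ¹⁺⁽ᴰ⁺³⁾` (coordinates `(z, u, τ, v)`), together with an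
explicit complementary `ℚ`-semialgebraic piece `L`, is `MIso`-isomorphic to the **catalytic cylinder**
`K × s̃`, `s̃ = s × (0,1) × (0,2)`: scale `v ↦ v (1 + u²)` (`MIso.scaleLast`, Jacobian `1 + u²`,
which is exactly the reciprocal of the Cauchy density at `u`) and move `u` to the front
(`MIso.perm`); the image is the part `{0 < x < 1, v < 1 + x²}` of the cylinder
`{(x, z, τ, v) | z ∈ s, τ ∈ (0,1), v ∈ (0,2)}` with density `ρ(z)/(1+x²)`, and `L` is the rest of it.
All charts are rational over `ℚ` (no disc, no polar coordinates).

References: crux NOTES c6 (F13) and the lead's absorption remark; M. Kontsevich, D. Zagier,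
*Periods* (2001), §1.2 rule (2).
-/

noncomputable section

-- `Summit.KontsevichZagierPeriods.KontsevichZagierPeriods.…` is the tree's mandated layout (single-conjunct summit).
set_option linter.dupNamespace false

namespace Summit.KontsevichZagierPeriods.KontsevichZagierPeriods.BetaCancellationDivisorSlicing

open MeasureTheory Set Function
open Literature.NumberTheory.Transcendental
open Literature.NumberTheory.Transcendental.KZ
open Literature.ModelTheory.ExponentialFields (IsSemialgebraic isSemialgebraic_univ)

variable (D : ℕ)

/-! ### The coordinate cycle bringing `u` (index `1 + D`) to the front -/

/-- The cycle `(0 ↦ 1+D, j+1 ↦ j for j ≤ D)` on the coordinates of `ℝ¹⁺⁽ᴰ⁺³⁾` (identity beyond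
`1 + D`), as a permutation. [folklore] -/
theorem exists_frontCycle : ∃ π : Equiv.Perm (Fin (1 + (D + 3))),
    (∀ i : Fin (1 + (D + 3)), (π i : ℕ) = if (i : ℕ) = 0 then 1 + D else
      if (i : ℕ) ≤ 1 + D then (i : ℕ) - 1 else (i : ℕ)) ∧
    (∀ i : Fin (1 + (D + 3)), (π.symm i : ℕ) = if (i : ℕ) = 1 + D then 0 else
      if (i : ℕ) < 1 + D then (i : ℕ) + 1 else (i : ℕ)) := by
  refine ⟨⟨fun i => if h0 : (i : ℕ) = 0 then ⟨1 + D, by omega⟩ else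
      if h1 : (i : ℕ) ≤ 1 + D then ⟨(i : ℕ) - 1, by omega⟩ else i,
    fun i => if h0 : (i : ℕ) = 1 + D then ⟨0, by omega⟩ else
      if h1 : (i : ℕ) < 1 + D then ⟨(i : ℕ) + 1, by omega⟩ else i, fun i => ?_, fun i => ?_⟩,
    fun i => ?_, fun i => ?_⟩
  · apply Fin.ext
    simp only
    split_ifs <;> first | (simp_all; done) | (simp_all; omega)
  · apply Fin.ext
    simp only
    split_ifs <;> first | (simp_all; done) | (simp_all; omega)
  · simp only [Equiv.coe_fn_mk]
    split_ifs <;> rfl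
  · simp only [Equiv.coe_fn_symm_mk]
    split_ifs <;> rfl

/-! ### The catalytic cylinder over `s̃` and the image part `E` are semialgebraic -/

/-- The catalytic cylinder over `s̃ = s × (0,1) × (0,2)` is `ℚ`-semialgebraic. [cite: BCR1998, §2.1] -/
theorem isSemialgebraic_tildeCyl {s : Set (Fin (1 + D) → ℝ)} (hs : IsSemialgebraic ℚ s) (hD : 1 + D ≤ D + 3) :
    IsSemialgebraic ℚ {w : Fin (1 + (D + 3)) → ℝ | (fun i : Fin (D + 3) => w (Fin.natAdd 1 i)) ∈
      {y : Fin (D + 3) → ℝ | (fun i : Fin (1 + D) => y (Fin.castLE hD i)) ∈ s ∧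
        y ⟨1 + D, by omega⟩ ∈ Ioo (0 : ℝ) 1 ∧ y (Fin.last (D + 2)) ∈ Ioo (0 : ℝ) 2}} := by
  let τL : Fin (D + 3) := ⟨1 + D, by omega⟩
  let vL : Fin (D + 3) := Fin.last (D + 2)
  have hA := Literature.ModelTheory.ExponentialFields.isSemialgebraic_setOf_eval_lt (k := ℚ) (R := ℝ)
    (0 : MvPolynomial (Fin (D + 3)) ℚ) (MvPolynomial.X τL)
  have hA' := Literature.ModelTheory.ExponentialFields.isSemialgebraic_setOf_eval_lt (k := ℚ) (R := ℝ)
    (MvPolynomial.X τL) (1 : MvPolynomial (Fin (D + 3)) ℚ)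
  have hC := Literature.ModelTheory.ExponentialFields.isSemialgebraic_setOf_eval_lt (k := ℚ) (R := ℝ)
    (0 : MvPolynomial (Fin (D + 3)) ℚ) (MvPolynomial.X vL)
  have hC' := Literature.ModelTheory.ExponentialFields.isSemialgebraic_setOf_eval_lt (k := ℚ) (R := ℝ)
    (MvPolynomial.X vL) (2 : MvPolynomial (Fin (D + 3)) ℚ)
  have hy : IsSemialgebraic ℚ {y : Fin (D + 3) → ℝ | (fun i : Fin (1 + D) => y (Fin.castLE hD i)) ∈ s ∧
      y ⟨1 + D, by omega⟩ ∈ Ioo (0 : ℝ) 1 ∧ y (Fin.last (D + 2)) ∈ Ioo (0 : ℝ) 2} := by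
    convert (hs.preimage_comp (Fin.castLE hD)).inter ((hA.inter hA').inter (hC.inter hC')) using 1
    ext y
    simp only [mem_setOf_eq, mem_Ioo, mem_inter_iff, mem_preimage, map_zero, MvPolynomial.aeval_X,
      map_one, map_ofNat, τL, vL]
    exact ⟨fun ⟨h1, h2, h3⟩ => ⟨h1, ⟨h2.1, h2.2⟩, h3.1, h3.2⟩,
      fun ⟨h1, ⟨h2, h2'⟩, h3, h3'⟩ => ⟨h1, ⟨h2, h2'⟩, h3, h3'⟩⟩
  exact hy.preimage_comp (Fin.natAdd 1)

/-- The image part `E = {0 < x₀ < 1, v < 1 + x₀²}` of the catalytic cylinder over `s̃` is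
`ℚ`-semialgebraic. [cite: BCR1998, §2.1] -/
theorem isSemialgebraic_absorbE {s : Set (Fin (1 + D) → ℝ)} (hs : IsSemialgebraic ℚ s) (hD : 1 + D ≤ D + 3) :
    IsSemialgebraic ℚ {w : Fin (1 + (D + 3)) → ℝ | (fun i : Fin (D + 3) => w (Fin.natAdd 1 i)) ∈
        {y : Fin (D + 3) → ℝ | (fun i : Fin (1 + D) => y (Fin.castLE hD i)) ∈ s ∧
          y ⟨1 + D, by omega⟩ ∈ Ioo (0 : ℝ) 1 ∧ y (Fin.last (D + 2)) ∈ Ioo (0 : ℝ) 2} ∧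
      w (Fin.castAdd (D + 3) 0) ∈ Ioo (0 : ℝ) 1 ∧
      w (Fin.natAdd 1 (Fin.last (D + 2))) < 1 + w (Fin.castAdd (D + 3) 0) ^ 2} := by
  have h0 := Literature.ModelTheory.ExponentialFields.isSemialgebraic_setOf_eval_lt (k := ℚ) (R := ℝ)
    (0 : MvPolynomial (Fin (1 + (D + 3))) ℚ) (MvPolynomial.X (Fin.castAdd (D + 3) 0))
  have h1 := Literature.ModelTheory.ExponentialFields.isSemialgebraic_setOf_eval_lt (k := ℚ) (R := ℝ)
    (MvPolynomial.X (Fin.castAdd (D + 3) 0)) (1 : MvPolynomial (Fin (1 + (D + 3))) ℚ)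
  have h2 := Literature.ModelTheory.ExponentialFields.isSemialgebraic_setOf_eval_lt (k := ℚ) (R := ℝ)
    (MvPolynomial.X (Fin.natAdd 1 (Fin.last (D + 2))) : MvPolynomial (Fin (1 + (D + 3))) ℚ)
    (1 + MvPolynomial.X (Fin.castAdd (D + 3) 0) ^ 2)
  convert (isSemialgebraic_tildeCyl D hs hD).inter ((h0.inter h1).inter h2) using 1
  ext w
  simp only [mem_setOf_eq, mem_Ioo, mem_inter_iff, map_zero, MvPolynomial.aeval_X, map_one, map_add, map_pow]

/-! ### Absorption -/

/-- **Absorbing one spectator into a catalytic cylinder.** For a `ℚ`-semialgebraic `s ⊆ ℝ¹⁺ᴰ` with a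
positive `ℚ`-semialgebraic density `ρ`, the thrice-stabilised measured set `(s × (0,1)³, ρ)` together
with the explicit piece `L` (density `ρ(tail)/(1+x₀²)`) is `MIso`-isomorphic to the catalytic cylinder
`{w | tail w ∈ s̃}`, `s̃ = s × (0,1) × (0,2)`, with density `ρ(tail)/(1+x₀²)`. [folklore] -/
theorem MIso.absorb {s : Set (Fin (1 + D) → ℝ)} (hs : IsSemialgebraic ℚ s) {ρ : (Fin (1 + D) → ℝ) → ℝ}
    (hρpos : ∀ x ∈ s, 0 < ρ x) (h3 : 1 + D ≤ 1 + (D + 3))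
    (hD : 1 + D ≤ D + 3) :
    Nonempty (MIso (1 + (D + 3))
      (Sum.elim (fun _ : Unit => stabSet h3 s) (fun _ : Unit =>
        {w : Fin (1 + (D + 3)) → ℝ | (fun i : Fin (D + 3) => w (Fin.natAdd 1 i)) ∈
          {y : Fin (D + 3) → ℝ | (fun i : Fin (1 + D) => y (Fin.castLE hD i)) ∈ s ∧
            y ⟨1 + D, by omega⟩ ∈ Ioo (0 : ℝ) 1 ∧ y (Fin.last (D + 2)) ∈ Ioo (0 : ℝ) 2}} \
        {w : Fin (1 + (D + 3)) → ℝ | (fun i : Fin (D + 3) => w (Fin.natAdd 1 i)) ∈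
          {y : Fin (D + 3) → ℝ | (fun i : Fin (1 + D) => y (Fin.castLE hD i)) ∈ s ∧
            y ⟨1 + D, by omega⟩ ∈ Ioo (0 : ℝ) 1 ∧ y (Fin.last (D + 2)) ∈ Ioo (0 : ℝ) 2} ∧
          w (Fin.castAdd (D + 3) 0) ∈ Ioo (0 : ℝ) 1 ∧
          w (Fin.natAdd 1 (Fin.last (D + 2))) < 1 + w (Fin.castAdd (D + 3) 0) ^ 2}))
      (Sum.elim (fun _ => stabFun h3 ρ) (fun _ w => 1 / (1 + w (Fin.castAdd (D + 3) 0) ^ 2) *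
        ρ (fun i : Fin (1 + D) => w (Fin.natAdd 1 (Fin.castLE hD i)))))
      (fun _ : Unit => {w : Fin (1 + (D + 3)) → ℝ | (fun i : Fin (D + 3) => w (Fin.natAdd 1 i)) ∈
          {y : Fin (D + 3) → ℝ | (fun i : Fin (1 + D) => y (Fin.castLE hD i)) ∈ s ∧
            y ⟨1 + D, by omega⟩ ∈ Ioo (0 : ℝ) 1 ∧ y (Fin.last (D + 2)) ∈ Ioo (0 : ℝ) 2}})
      (fun _ w => 1 / (1 + w (Fin.castAdd (D + 3) 0) ^ 2) *
        ρ (fun i : Fin (1 + D) => w (Fin.natAdd 1 (Fin.castLE hD i))))) := by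
  -- notation: levels `1 + D ≤ 1 + D + 2 ≤ 1 + D + 2 + 1 = 1 + (D + 3)`
  have h2 : 1 + D ≤ 1 + D + 2 := by omega
  set B : Set (Fin (1 + D + 2) → ℝ) := stabSet h2 s with hB_def
  have hB : IsSemialgebraic ℚ B := isSemialgebraic_stabSet h2 hs
  let uB : Fin (1 + D + 2) := ⟨1 + D, by omega⟩
  set β : (Fin (1 + D + 2) → ℝ) → ℝ := fun y => 1 + y uB ^ 2 with hβ_def
  have hβs : IsSemialgebraicFunOn ℚ B β :=
    (isSemialgebraicFunOn_aeval hB (1 + MvPolynomial.X uB ^ 2)).congr fun y _ => by simp [hβ_def]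
  have hβd : Differentiable ℝ β := by
    simp only [hβ_def]; fun_prop
  have hβpos : ∀ y ∈ B, 0 < β y := fun y _ => by simp only [hβ_def]; positivity
  set ρ₀ : (Fin (1 + D + 2) → ℝ) → ℝ := stabFun h2 ρ with hρ₀_def
  -- step 1: scale the last coordinate
  obtain ⟨m₁⟩ := MIso.scaleLast hB hβs hβd hβpos ρ₀
  -- the source slot of `m₁` is the thrice-stabilised `s`
  have hS₁ : {z : Fin (1 + D + 2 + 1) → ℝ | (Fin.init z : Fin (1 + D + 2) → ℝ) ∈ B ∧
      0 < z (Fin.last (1 + D + 2)) ∧ z (Fin.last (1 + D + 2)) < 1} = stabSet h3 s := by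
    have : stabSet h3 s = stabSet (Nat.le_succ (1 + D + 2)) (stabSet h2 s) :=
      (stabSet_stabSet h2 (Nat.le_succ _) s).symm
    rw [this]
    ext z
    rw [mem_stabSet_succ]
    simp only [mem_setOf_eq, mem_Ioo, hB_def]
  have hρS : ∀ z : Fin (1 + D + 2 + 1) → ℝ, ρ₀ (Fin.init z) = stabFun h3 ρ z := fun z => by
    rw [hρ₀_def, ← stabFun_stabFun h2 (Nat.le_succ (1 + D + 2)) ρ]
    rfl
  -- step 2: the cycle bringing `u` to the front
  obtain ⟨π, hπ, hπs⟩ := exists_frontCycle D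
  set T₁ := {z : Fin (1 + D + 2 + 1) → ℝ | (Fin.init z : Fin (1 + D + 2) → ℝ) ∈ B ∧
    0 < z (Fin.last (1 + D + 2)) ∧ z (Fin.last (1 + D + 2)) < β (Fin.init z)} with hT₁_def
  have hT₁ : IsSemialgebraic ℚ T₁ := by
    have hcyl : IsSemialgebraic ℚ {z : Fin (1 + D + 2 + 1) → ℝ | (Fin.init z : Fin (1 + D + 2) → ℝ) ∈ B} :=
      hB.preimage_comp Fin.castSucc
    have hβi : IsSemialgebraicFunOn ℚ {z : Fin (1 + D + 2 + 1) → ℝ |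
        (Fin.init z : Fin (1 + D + 2) → ℝ) ∈ B} (fun z => β (Fin.init z)) :=
      hβs.comp_init_mono hcyl fun _ h => h
    have hli := isSemialgebraicFunOn_apply hcyl (Fin.last (1 + D + 2))
    have hzero : IsSemialgebraicFunOn ℚ {z : Fin (1 + D + 2 + 1) → ℝ |
        (Fin.init z : Fin (1 + D + 2) → ℝ) ∈ B} (fun _ => (0 : ℝ)) := by
      simpa using isSemialgebraicFunOn_aeval hcyl (0 : MvPolynomial (Fin (1 + D + 2 + 1)) ℚ)
    have h1 := isSemialgebraic_sep_lt' hzero hli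
    have h2' := isSemialgebraic_sep_lt' hli hβi
    convert h1.inter h2' using 1
    ext z
    simp only [hT₁_def, mem_setOf_eq, mem_inter_iff]
    tauto
  set θ₁ : (Fin (1 + D + 2 + 1) → ℝ) → ℝ := fun z => ρ₀ (Fin.init z) / β (Fin.init z) with hθ₁_def
  obtain ⟨m₂⟩ := MIso.perm π hT₁ θ₁
  -- step 3: compose
  obtain ⟨m₁₂⟩ := m₁.trans m₂ (fun _ z hz => hρpos _ hz.1.1) (fun _ => hT₁)
  -- coordinates of `w ∘ π⁻¹`
  have hc_s : ∀ (w : Fin (1 + (D + 3)) → ℝ) (i : Fin (1 + D)),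
      (w ∘ π.symm) (Fin.castSucc (Fin.castLE h2 i)) = w (Fin.natAdd 1 (Fin.castLE hD i)) := by
    intro w i
    show w (π.symm _) = w _
    congr 1
    apply Fin.ext
    rw [hπs]
    have hi := i.is_lt
    simp only [Fin.val_castSucc, Fin.val_castLE, Fin.val_natAdd]
    rw [if_neg (by omega), if_pos hi]
    omega
  have hc_u : ∀ w : Fin (1 + (D + 3)) → ℝ,
      (w ∘ π.symm) (Fin.castSucc uB) = w (Fin.castAdd (D + 3) 0) := by
    intro w
    show w (π.symm _) = w _
    congr 1
    apply Fin.ext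
    rw [hπs]
    simp [uB]
  let τB : Fin (1 + D + 2) := ⟨2 + D, by omega⟩
  let τL : Fin (D + 3) := ⟨1 + D, by omega⟩
  have hc_τ : ∀ w : Fin (1 + (D + 3)) → ℝ,
      (w ∘ π.symm) (Fin.castSucc τB) = w (Fin.natAdd 1 τL) := by
    intro w
    show w (π.symm _) = w _
    congr 1
    apply Fin.ext
    rw [hπs]
    simp only [Fin.val_castSucc, Fin.val_natAdd, τB, τL]
    rw [if_neg (by omega), if_neg (by omega)]
    omega
  have hc_v : ∀ w : Fin (1 + (D + 3)) → ℝ,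
      (w ∘ π.symm) (Fin.last (1 + D + 2)) = w (Fin.natAdd 1 (Fin.last (D + 2))) := by
    intro w
    show w (π.symm _) = w _
    congr 1
    apply Fin.ext
    rw [hπs]
    simp only [Fin.val_last, Fin.val_natAdd]
    rw [if_neg (by omega), if_neg (by omega)]
    omega
  have hinitB : ∀ w : Fin (1 + (D + 3)) → ℝ, (Fin.init (w ∘ π.symm) : Fin (1 + D + 2) → ℝ) ∈ B ↔
      (fun i : Fin (1 + D) => w (Fin.natAdd 1 (Fin.castLE hD i))) ∈ s ∧
        w (Fin.castAdd (D + 3) 0) ∈ Ioo (0 : ℝ) 1 ∧ w (Fin.natAdd 1 τL) ∈ Ioo (0 : ℝ) 1 := by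
    intro w
    rw [hB_def, mem_stabSet]
    have h1 : (fun i : Fin (1 + D) => Fin.init (w ∘ π.symm) (Fin.castLE h2 i)) =
        fun i : Fin (1 + D) => w (Fin.natAdd 1 (Fin.castLE hD i)) := by
      funext i
      exact hc_s w i
    rw [h1]
    have hu' : Fin.init (w ∘ π.symm) uB = w (Fin.castAdd (D + 3) 0) := hc_u w
    have hτ' : Fin.init (w ∘ π.symm) τB = w (Fin.natAdd 1 τL) := hc_τ w
    refine and_congr Iff.rfl ⟨fun h => ⟨?_, ?_⟩, fun h j hj => ?_⟩
    · have := h uB le_rfl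
      rwa [hu'] at this
    · have := h τB (by simp [τB])
      rwa [hτ'] at this
    · have hj' := j.is_lt
      rcases Nat.lt_or_ge (j : ℕ) (2 + D) with hlt | hge
      · have : j = uB := Fin.ext (by simp [uB]; omega)
        rw [this, hu']
        exact h.1
      · have : j = τB := Fin.ext (by simp [τB]; omega)
        rw [this, hτ']
        exact h.2
  have hβw : ∀ w : Fin (1 + (D + 3)) → ℝ, β (Fin.init (w ∘ π.symm)) =
      1 + w (Fin.castAdd (D + 3) 0) ^ 2 := fun w => by
    simp only [hβ_def]
    rw [show Fin.init (w ∘ π.symm) uB = w (Fin.castAdd (D + 3) 0) from hc_u w]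
  have hρw : ∀ w : Fin (1 + (D + 3)) → ℝ, ρ₀ (Fin.init (w ∘ π.symm)) =
      ρ (fun i : Fin (1 + D) => w (Fin.natAdd 1 (Fin.castLE hD i))) := fun w => by
    simp only [hρ₀_def, stabFun_apply]
    congr 1
    funext i
    exact hc_s w i
  -- the image of the composite is the part `E` of the cylinder
  have hT₂ : ∀ w : Fin (1 + (D + 3)) → ℝ, w ∘ π.symm ∈ T₁ ↔
      ((fun i : Fin (1 + D) => w (Fin.natAdd 1 (Fin.castLE hD i))) ∈ s ∧
        w (Fin.natAdd 1 τL) ∈ Ioo (0 : ℝ) 1 ∧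
        w (Fin.natAdd 1 (Fin.last (D + 2))) ∈ Ioo (0 : ℝ) 2) ∧
      w (Fin.castAdd (D + 3) 0) ∈ Ioo (0 : ℝ) 1 ∧
      w (Fin.natAdd 1 (Fin.last (D + 2))) < 1 + w (Fin.castAdd (D + 3) 0) ^ 2 := by
    intro w
    show (Fin.init (w ∘ π.symm) ∈ B ∧ 0 < (w ∘ π.symm) (Fin.last (1 + D + 2)) ∧
      (w ∘ π.symm) (Fin.last (1 + D + 2)) < β (Fin.init (w ∘ π.symm))) ↔ _
    rw [hinitB, hβw, hc_v]
    constructor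
    · rintro ⟨⟨hs', h0, hτ⟩, hv0, hv1⟩
      refine ⟨⟨hs', hτ, hv0, ?_⟩, h0, hv1⟩
      nlinarith [h0.1, h0.2]
    · rintro ⟨⟨hs', hτ, hv0, -⟩, h0, hv1⟩
      exact ⟨⟨hs', h0, hτ⟩, hv0, hv1⟩
  have hθw : ∀ w : Fin (1 + (D + 3)) → ℝ, θ₁ (w ∘ π.symm) =
      1 / (1 + w (Fin.castAdd (D + 3) 0) ^ 2) *
        ρ (fun i : Fin (1 + D) => w (Fin.natAdd 1 (Fin.castLE hD i))) := fun w => by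
    simp only [hθ₁_def, hρw, hβw]
    ring
  -- semialgebraicity of the cylinder and of `E`
  have htail := isSemialgebraic_tildeCyl D hs hD
  -- step 4: add the complementary piece and merge the two target slots into the cylinder
  set Kc := {w : Fin (1 + (D + 3)) → ℝ | (fun i : Fin (D + 3) => w (Fin.natAdd 1 i)) ∈
      {y : Fin (D + 3) → ℝ | (fun i : Fin (1 + D) => y (Fin.castLE hD i)) ∈ s ∧
        y ⟨1 + D, by omega⟩ ∈ Ioo (0 : ℝ) 1 ∧ y (Fin.last (D + 2)) ∈ Ioo (0 : ℝ) 2}} with hKc_def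
  set E := {w : Fin (1 + (D + 3)) → ℝ | (fun i : Fin (D + 3) => w (Fin.natAdd 1 i)) ∈
      {y : Fin (D + 3) → ℝ | (fun i : Fin (1 + D) => y (Fin.castLE hD i)) ∈ s ∧
        y ⟨1 + D, by omega⟩ ∈ Ioo (0 : ℝ) 1 ∧ y (Fin.last (D + 2)) ∈ Ioo (0 : ℝ) 2} ∧
      w (Fin.castAdd (D + 3) 0) ∈ Ioo (0 : ℝ) 1 ∧
      w (Fin.natAdd 1 (Fin.last (D + 2))) < 1 + w (Fin.castAdd (D + 3) 0) ^ 2} with hE_def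
  have hKE : ∀ w, w ∈ E ↔ w ∘ π.symm ∈ T₁ := fun w => by rw [hT₂]; rfl
  have hEK : E ⊆ Kc := fun w hw => hw.1
  have hE : IsSemialgebraic ℚ E := isSemialgebraic_absorbE D hs hD
  have hL : IsSemialgebraic ℚ (Kc \ E) := htail.diff hE
  obtain ⟨mr⟩ := MIso.refl (N := 1 + (D + 3)) (ι := Unit) (σ := fun _ => Kc \ E)
    (ρ := fun _ w => 1 / (1 + w (Fin.castAdd (D + 3) 0) ^ 2) *
      ρ (fun i : Fin (1 + D) => w (Fin.natAdd 1 (Fin.castLE hD i)))) (fun _ => hL)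
  obtain ⟨m₃⟩ := m₁₂.sum mr
  refine m₃.merge id (fun _ => ()) ?_ ?_ (fun _ _ h h' => (h h').elim) ?_ ?_ ?_
  · rintro (_ | _)
    · refine ⟨fun z hz => ?_, fun z _ => ?_⟩
      · show z ∈ stabSet h3 s
        rw [← hS₁]
        exact hz
      · exact hρS z
    · exact ⟨fun z hz => hz, fun z _ => rfl⟩
  · rintro (_ | _)
    · refine ⟨fun w hw => ?_, fun w hw => ?_⟩
      · exact hEK ((hKE w).mpr hw)
      · exact hθw w
    · exact ⟨fun w hw => hw.1, fun w _ => rfl⟩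
  · rintro (_ | _) (_ | _) hne _
    · exact absurd rfl hne
    · refine measure_mono_null (fun w hw => ?_) measure_empty
      exact hw.2.2 ((hKE w).mpr hw.1)
    · refine measure_mono_null (fun w hw => ?_) measure_empty
      exact hw.1.2 ((hKE w).mpr hw.2)
    · exact absurd rfl hne
  · rintro (_ | _)
    · refine measure_mono_null (fun z hz => ?_) measure_empty
      simp only [Set.mem_sdiff, Sum.elim_inl, mem_iUnion, exists_prop, not_exists, not_and, id_eq] at hz
      refine hz.2 (Sum.inl ()) rfl ?_
      simp only [Sum.elim_inl]
      rw [hS₁]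
      exact hz.1
    · refine measure_mono_null (fun z hz => ?_) measure_empty
      simp only [Set.mem_sdiff, Sum.elim_inr, mem_iUnion, exists_prop, not_exists, not_and, id_eq] at hz
      exact hz.2 (Sum.inr ()) rfl hz.1
  · intro _
    refine measure_mono_null (fun w hw => ?_) measure_empty
    have hw1 := hw.1
    have hw2 : ∀ p : Unit ⊕ Unit, w ∉ Sum.elim (fun _ => {w : Fin (1 + D + 2 + 1) → ℝ | w ∘ π.symm ∈ T₁})
        (fun _ => Kc \ E) p := fun p hp => hw.2 (mem_iUnion₂.mpr ⟨p, rfl, hp⟩)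
    by_cases hwE : w ∈ E
    · exact hw2 (Sum.inl ()) ((hKE w).mp hwE)
    · exact hw2 (Sum.inr ()) ⟨hw1, hwE⟩

/-! ### Headline -/

/-- Registered helper goal of the stub `stub_tameForm`: the coordinate cycle bringing the
catalytic coordinate to the front. [folklore] -/
theorem tameForm_aux_frontCycle : ∀ D : ℕ, ∃ π : Equiv.Perm (Fin (1 + (D + 3))), (∀ i : Fin (1 + (D + 3)), (π i : ℕ) = if (i : ℕ) = 0 then 1 + D else if (i : ℕ) ≤ 1 + D then (i : ℕ) - 1 else (i : ℕ)) ∧ (∀ i : Fin (1 + (D + 3)), (π.symm i : ℕ) = if (i : ℕ) = 1 + D then 0 else if (i : ℕ) < 1 + D then (i : ℕ) + 1 else (i : ℕ)) :=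
  fun D => exists_frontCycle D

end Summit.KontsevichZagierPeriods.KontsevichZagierPeriods.BetaCancellationDivisorSlicing

end
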